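import Literature.MathematicalPhysics.QuantumLattice.HubbardSpinReflectionSignRule
import Literature.MathematicalPhysics.QuantumLattice.HubbardCorrelatorCertificate
import Literature.MathematicalPhysics.QuantumLattice.HubbardNNNHoppingLocalHamiltonian
import Literature.MathematicalPhysics.QuantumLattice.HubbardNNNHoppingParticleHole
import HarnessLib

/-!
# The Shen–Qiu–Tian sign rule in infinite volume: antiferromagnetic short-range correlations of
# every torus-limit ground state of the half-filled square-lattice Hubbard model

Topic `Literature/MathematicalPhysics/QuantumLattice`; namespace
`Literature.MathematicalPhysics.QuantumLattice` (the file path). Companion of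
`HubbardSpinReflectionSignRule` (the finite-volume sign rule of Shen–Qiu–Tian, proved there from
Lieb's spin-reflection positivity: for THE half-filled ground state `ψ` of a connected balanced
bipartite graph, `ε_x ε_y ⟨ψ, 𝐒_x·𝐒_y ψ⟩ ≥ 0`) and of `HubbardCorrelatorCertificate`
(torus-limit ground states `InfVolFermionState.IsTorusLimitOf` of the half-filled square lattice and
the bundle papers/HubbardSuperconductivity/manybody-bootstrap/'s certified correlator intervals, format
`certsdp/1` §6 objectives `spin_nn`, `spin_nnn`).

The sign rule is a statement about every finite even torus `(ℤ/Lℤ)²` (`hubbardTorus_shenQiuTian_sign_rule`,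
`hubbardTorus_re_expect_fermionSpinDot_nonpos_of_adj`). Weak inequalities survive weak-⋆ limits of
translation averages, so it passes to every infinite-volume state of `ℤ²` that is a torus limit of
half-filled ground states (`t ≠ 0`, `U > 0`, even `L → ∞`):

* `hubbardTorus_torusStagger_mul_re_expect_fermionSpinDot_nonneg`: stagger form of the finite-volume
  rule, `0 ≤ ε_x ε_y Re ⟨ψ, 𝐒_x·𝐒_y ψ⟩` with `ε_x = (-1)^{x₁+x₂}` (`torusStagger`), every half-filled
  ground state of the even torus; `hubbardTorus_re_expect_fermionSpinDot_nonneg_of_diagAdj`: diagonal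
  (next-nearest) neighbours are positively correlated.
* `re_torusAvgExpectAt_nonneg_of_forall` / `…_nonpos_of_forall`,
  `InfVolFermionState.IsTorusLimitOf.re_expect_nonneg_of_eventually` / `…_nonpos_of_eventually`:
  the transfer — a sign valid for every translate of the torus vector is valid for the translation
  average, and an eventually valid sign is valid in the limit (Bratteli–Robinson I §4.3.1).
* `InfVolFermionState.IsTorusLimitOf.re_expect_spinDotAt_nonpos_of_adj`: for every torus-limit
  half-filled ground state `ω` of `ℤ²`, every region `Λ` and nearest neighbours `x ∼ y` in `Λ`,
  `Re ω_Λ(𝐒_x·𝐒_y) ≤ 0`; `…_nonneg_of_diag`: `Re ω_Λ(𝐒_x·𝐒_y) ≥ 0` for diagonal neighbours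
  `y = x ± e₁ ± e₂`.
* Row-shaped forms on the supports used by the bundle: `…re_expect_sum_spinDotAt_unitVec_nonpos`
  (`Re ω_{\{0,e₁,e₂\}}(Σ_i 𝐒_0·𝐒_{e_i}) ≤ 0`) and `…re_expect_sum_spinDotAt_diag_nonneg`
  (`Re ω_{\{0,e₁+e₂,e₁-e₂\}}(𝐒_0·𝐒_{e₁+e₂} + 𝐒_0·𝐒_{e₁-e₂}) ≥ 0`).

HONEST SCOPE. These are SIGNS, valid at every `U > 0` with no numerical input; they say nothing about
magnitudes (the bundle's certificates do: e.g. `C₁(U=8) ≤ -0.0557`, `C₁(U=4) ≤ -0.0013`) and nothing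
about long-range order (Lieb 1993, Problem 1, open). The states covered are the torus limits of
half-filled ground states along even sides — the class all thermodynamic-limit rows of the bundle
quantify over — not arbitrary infinite-volume ground states. Everything is PROVED; no definition, no
named fact, no `sorry`.

## References
* S.-Q. Shen, Z.-M. Qiu, G.-S. Tian, *Ferrimagnetic long-range order of the Hubbard model*,
  Phys. Rev. Lett. 72 (1994) 1280 — the sign rule for the spin correlations of the half-filled ground
  state. [cite: ShenQiuTian1994, Theorem and eqs. (7)–(9)]
* G.-S. Tian, *Lieb's spin-reflection-positivity method and its applications to strongly correlated
  electron systems*, J. Stat. Phys. 116 (2004) 629, §3. [cite: Tian2004, §3]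
* H. Tasaki, *The Hubbard model: introduction and selected rigorous results*, arXiv:cond-mat/9512169,
  Theorem 5.3 (explicit signs of correlations). [cite: ShenQiuTian1994, Theorem and eqs. (7)–(9)]
* E. H. Lieb, *The Hubbard model: some rigorous results and open problems*, arXiv:cond-mat/9311033,
  §B Problem 1 (antiferromagnetic long-range order at half filling is open). [cite: arXiv9311033]
* O. Bratteli, D. W. Robinson, *Operator Algebras and Quantum Statistical Mechanics I*, §4.3.1
  (invariant states as limits of averages; weak-⋆ closedness of positivity conditions).
  [cite: BratteliRobinsonI1987, §4.3.1]
-/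

noncomputable section

namespace Literature.MathematicalPhysics.QuantumLattice

open Matrix Finset HubbardWave0 Literature.Probability.LatticeModels FermionSpinMoment
open Filter _root_.Topology
open scoped ComplexOrder BigOperators

/-! ### §1 The finite even torus: the sign rule in stagger form -/

section Torus

variable {L : ℕ} [NeZero L]

omit [NeZero L] in
/-- `|(ℤ/Lℤ)²| = L²`. [folklore] -/
private theorem card_fermionTorus_two : Fintype.card (FermionTorus 2 L) = L ^ 2 := by
  simp only [FermionTorus, Fintype.card_lex, Fintype.card_fun, Fintype.card_fin]

omit [NeZero L] in
/-- The colour-class sign of the torus bipartition `A = {x : ε_x = +1}` IS the staggering sign: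
`stagSign A x = ε_x = (-1)^{x₁+x₂}` (as a complex number). [cite: LiebPRL1989, Theorem 2] -/
theorem stagSign_filter_torusStagger_eq (x : FermionTorus 2 L) :
    stagSign (univ.filter fun z : FermionTorus 2 L => torusStagger z = 1) x = ((torusStagger x : ℤ) : ℂ) := by
  unfold stagSign
  rcases Int.units_eq_one_or (torusStagger x) with h | h
  · have hx : x ∈ univ.filter fun z : FermionTorus 2 L => torusStagger z = 1 :=
      mem_filter.2 ⟨mem_univ _, h⟩
    rw [if_pos hx, h, Units.val_one, Int.cast_one]
  · have hx : x ∉ univ.filter fun z : FermionTorus 2 L => torusStagger z = 1 := by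
      intro hm
      have h1 : torusStagger x = 1 := (mem_filter.1 hm).2
      rw [h] at h1
      exact absurd h1 (by decide)
    rw [if_neg hx, h, Units.val_neg, Units.val_one, Int.cast_neg, Int.cast_one]

omit [NeZero L] in
/-- `ε_x ε_x = 1` for the staggering sign, real form. [folklore] -/
private theorem torusStagger_cast_mul_self (x : FermionTorus 2 L) :
    ((torusStagger x : ℤ) : ℝ) * ((torusStagger x : ℤ) : ℝ) = 1 := by
  rw [← Int.cast_mul, ← Units.val_mul, Int.units_mul_self, Units.val_one, Int.cast_one]

/-- **The Shen–Qiu–Tian sign rule on the even square torus, stagger form.** For every half-filled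
ground state `ψ` of `hamiltonian (fermionTorusGraph 2 L) t U` (`L` even, `t ≠ 0`, `U > 0`) and all
sites `x, y`: `0 ≤ ε_x ε_y · Re ⟨ψ, 𝐒_x·𝐒_y ψ⟩` with `ε_x = (-1)^{x₁+x₂}` — spins on the same
sublattice are positively, on opposite sublattices negatively correlated (SU(2) isotropy of the
unique singlet ground state turns the printed `S⁺S⁻` rule into the rule for `𝐒_x·𝐒_y`,
`stagSign_mul_expect_fermionSpinDot_nonneg`). [cite: ShenQiuTian1994, Theorem and eqs. (7)–(9)] [cite: Tian2004, §3] -/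
theorem hubbardTorus_torusStagger_mul_re_expect_fermionSpinDot_nonneg (hL : Even L) {t U : ℝ}
    (ht : t ≠ 0) (hU : 0 < U) {ψ : Fock (Orb (FermionTorus 2 L))} (hN : IsNParticle (L ^ 2) ψ)
    (hHψ : hamiltonian (fermionTorusGraph 2 L) t U *ᵥ ψ =
      ((groundEnergyAt (fermionTorusGraph 2 L) t U (L ^ 2) : ℝ) : ℂ) • ψ) (x y : FermionTorus 2 L) :
    0 ≤ ((torusStagger x : ℤ) : ℝ) * ((torusStagger y : ℤ) : ℝ) *
      (star ψ ⬝ᵥ (fermionSpinDot x y *ᵥ ψ)).re := by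
  obtain ⟨hG, hA, h2, -⟩ := LiebHalfFilled.hubbardTorus_lieb_hypotheses (L := L) hL
  have hcard := LiebHalfFilled.compl_card_eq_card_of_two_mul h2
  rw [← card_fermionTorus_two] at hN hHψ
  have h := stagSign_mul_expect_fermionSpinDot_nonneg hG _ hA hcard ht hU hN hHψ x y
  rw [stagSign_filter_torusStagger_eq, stagSign_filter_torusStagger_eq, ← Complex.ofReal_intCast,
    ← Complex.ofReal_intCast, ← Complex.ofReal_mul] at h
  have h' := (Complex.nonneg_iff.mp h).1
  rwa [Complex.re_ofReal_mul] at h'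

/-- **Diagonal neighbours of THE half-filled ground state are positively correlated**: on the even
square torus, `x` and `y = x ± e₁ ± e₂` lie on the same sublattice (`torusStagger_eq_of_diagAdj`), so
`0 ≤ Re ⟨ψ, 𝐒_x·𝐒_y ψ⟩` for every half-filled ground state (`L` even, `t ≠ 0`, `U > 0`).
[cite: ShenQiuTian1994, Theorem and eqs. (7)–(9)] -/
theorem hubbardTorus_re_expect_fermionSpinDot_nonneg_of_diagAdj (hL : Even L) {t U : ℝ}
    (ht : t ≠ 0) (hU : 0 < U) {ψ : Fock (Orb (FermionTorus 2 L))} (hN : IsNParticle (L ^ 2) ψ)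
    (hHψ : hamiltonian (fermionTorusGraph 2 L) t U *ᵥ ψ =
      ((groundEnergyAt (fermionTorusGraph 2 L) t U (L ^ 2) : ℝ) : ℂ) • ψ) {x y : FermionTorus 2 L}
    (hxy : (fermionTorusDiagGraph L).Adj x y) :
    0 ≤ (star ψ ⬝ᵥ (fermionSpinDot x y *ᵥ ψ)).re := by
  have h := hubbardTorus_torusStagger_mul_re_expect_fermionSpinDot_nonneg hL ht hU hN hHψ x y
  rwa [torusStagger_eq_of_diagAdj hL hxy, torusStagger_cast_mul_self, one_mul] at h

end Torus

/-! ### §2 Transfer: signs valid for every translate pass to the average and to the limit -/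

section Transfer

variable {d L : ℕ} [NeZero L]

/-- **A sign valid for every translate is valid for the translation average**: if
`0 ≤ Re ⟨U_v φ, Γ(ι_{Λ,L}) A U_v φ⟩` for all torus translations `v`, then
`0 ≤ Re torusAvgExpectAt L Λ A φ` (an average of non-negative reals). [cite: BratteliRobinsonI1987, §4.3.1] -/
theorem re_torusAvgExpectAt_nonneg_of_forall {Λ : Finset (Site d)}
    (hInj : Set.InjOn (Torus.proj (d := d) L) ↑Λ) (A : FermionOp Λ) (φ : Fock (Orb (FermionTorus d L)))
    (h : ∀ v : TorusSite d L,
      0 ≤ (expect (fermionEmbed (PolySite.toTorusEmb L hInj) A) ((fockTranslate v).val *ᵥ φ)).re) :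
    0 ≤ (torusAvgExpectAt L Λ A φ).re := by
  rw [torusAvgExpectAt_of_injOn L hInj A φ, ← Complex.ofReal_natCast, ← Complex.ofReal_inv,
    Complex.re_ofReal_mul, Complex.re_sum]
  exact mul_nonneg (inv_nonneg.2 (Nat.cast_nonneg _)) (Finset.sum_nonneg fun v _ => h v)

/-- The same for the opposite sign: if `Re ⟨U_v φ, Γ(ι_{Λ,L}) A U_v φ⟩ ≤ 0` for all `v`, then
`Re torusAvgExpectAt L Λ A φ ≤ 0`. [cite: BratteliRobinsonI1987, §4.3.1] -/
theorem re_torusAvgExpectAt_nonpos_of_forall {Λ : Finset (Site d)}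
    (hInj : Set.InjOn (Torus.proj (d := d) L) ↑Λ) (A : FermionOp Λ) (φ : Fock (Orb (FermionTorus d L)))
    (h : ∀ v : TorusSite d L,
      (expect (fermionEmbed (PolySite.toTorusEmb L hInj) A) ((fockTranslate v).val *ᵥ φ)).re ≤ 0) :
    (torusAvgExpectAt L Λ A φ).re ≤ 0 := by
  rw [torusAvgExpectAt_of_injOn L hInj A φ, ← Complex.ofReal_natCast, ← Complex.ofReal_inv,
    Complex.re_ofReal_mul, Complex.re_sum]
  have hc : (0 : ℝ) ≤ ((Fintype.card (TorusSite d L) : ℕ) : ℝ)⁻¹ := inv_nonneg.2 (Nat.cast_nonneg _)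
  calc ((Fintype.card (TorusSite d L) : ℕ) : ℝ)⁻¹ *
        ∑ v : TorusSite d L, (expect (fermionEmbed (PolySite.toTorusEmb L hInj) A) ((fockTranslate v).val *ᵥ φ)).re
      ≤ ((Fintype.card (TorusSite d L) : ℕ) : ℝ)⁻¹ * 0 :=
        mul_le_mul_of_nonneg_left (Finset.sum_nonpos fun v _ => h v) hc
    _ = 0 := mul_zero _

omit [NeZero L] in
/-- **An eventually valid sign is valid in the torus limit**: if the translation-averaged torus
expectations of `A` along the sides `Ls j` are eventually `≥ 0` (real part), then `Re ω_Λ(A) ≥ 0` for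
the torus-limit state `ω` (closedness of `[0, ∞)`; weak-⋆ limits preserve positivity conditions).
[cite: BratteliRobinsonI1987, §4.3.1] -/
theorem InfVolFermionState.IsTorusLimitOf.re_expect_nonneg_of_eventually {ω : InfVolFermionState d}
    {ψ : ∀ L, Fock (Orb (FermionTorus d L))} {Ls : ℕ → ℕ} (hω : ω.IsTorusLimitOf ψ Ls)
    {Λ : Finset (Site d)} (A : FermionOp Λ)
    (h : ∀ᶠ j in atTop, 0 ≤ (torusAvgExpect (Ls j) Λ A (ψ (Ls j))).re) :
    0 ≤ (ω.expect Λ A).re :=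
  ge_of_tendsto ((Complex.continuous_re.tendsto _).comp (hω Λ A)) h

omit [NeZero L] in
/-- The same for the opposite sign: eventually `Re ≤ 0` along the torus averages gives
`Re ω_Λ(A) ≤ 0`. [cite: BratteliRobinsonI1987, §4.3.1] -/
theorem InfVolFermionState.IsTorusLimitOf.re_expect_nonpos_of_eventually {ω : InfVolFermionState d}
    {ψ : ∀ L, Fock (Orb (FermionTorus d L))} {Ls : ℕ → ℕ} (hω : ω.IsTorusLimitOf ψ Ls)
    {Λ : Finset (Site d)} (A : FermionOp Λ)
    (h : ∀ᶠ j in atTop, (torusAvgExpect (Ls j) Λ A (ψ (Ls j))).re ≤ 0) :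
    (ω.expect Λ A).re ≤ 0 :=
  le_of_tendsto ((Complex.continuous_re.tendsto _).comp (hω Λ A)) h

end Transfer

/-! ### §3 Torus-limit ground states of the half-filled square lattice -/

section Limit

/-- The pull-back of the window correlator is the torus correlator of the images:
`Γ(ι_{Λ,L}) (𝐒_x·𝐒_y) = 𝐒_{x mod L}·𝐒_{y mod L}`. [cite: ArakiMoriya2003, §4.1 Def. 4.1 (2) and Def. 4.3] -/
theorem fermionEmbed_toTorusEmb_spinDotAt (L : ℕ) [NeZero L] {Λ : Finset (Site 2)}
    (hInj : Set.InjOn (Torus.proj (d := 2) L) ↑Λ) {x y : Site 2} (hx : x ∈ Λ) (hy : y ∈ Λ) :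
    fermionEmbed (PolySite.toTorusEmb L hInj) (spinDotAt x hx y hy) =
      fermionSpinDot (FermionTorus.ofTorusSite (Torus.proj L x)) (FermionTorus.ofTorusSite (Torus.proj L y)) :=
  fermionEmbed_fermionSpinDot _ _ _

/-- **The Shen–Qiu–Tian sign rule in infinite volume — nearest neighbours are antiferromagnetically
correlated.** Let `ω` be a torus limit of half-filled ground states `ψ_L` (`N = L²`) of
`hamiltonian (fermionTorusGraph 2 L) t U` along even `L → ∞`, `t ≠ 0`, `U > 0`. Then for every region
`Λ ⊂ ℤ²` and nearest neighbours `x ∼ y` in `Λ`: `Re ω_Λ(𝐒_x·𝐒_y) ≤ 0`. (Finite-volume rule on each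
torus for every translate of `ψ_L`, which is again a ground state; average; limit.)
[cite: ShenQiuTian1994, Theorem and eqs. (7)–(9)] [cite: BratteliRobinsonI1987, §4.3.1] -/
theorem InfVolFermionState.IsTorusLimitOf.re_expect_spinDotAt_nonpos_of_adj {t U : ℝ} (ht : t ≠ 0)
    (hU : 0 < U) {Ls : ℕ → ℕ} (hLs : Tendsto Ls atTop atTop) (hev : ∀ j, Even (Ls j))
    {ψ : ∀ L, Fock (Orb (FermionTorus 2 L))}
    (hψ : ∀ j, _root_.Literature.MathematicalPhysics.QuantumLattice.IsGroundState
      (hamiltonian (fermionTorusGraph 2 (Ls j)) t U) (Ls j ^ 2) (ψ (Ls j)))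
    {ω : InfVolFermionState 2} (hω : ω.IsTorusLimitOf ψ Ls)
    {Λ : Finset (Site 2)} {x y : Site 2} (hx : x ∈ Λ) (hy : y ∈ Λ) (hxy : (zdGraph 2).Adj x y) :
    (ω.expect Λ (spinDotAt x hx y hy)).re ≤ 0 := by
  refine hω.re_expect_nonpos_of_eventually (spinDotAt x hx y hy) ?_
  obtain ⟨L₀, hL₀⟩ := exists_forall_le_injOn_proj (thicken Λ 1)
  filter_upwards [hLs.eventually (eventually_ge_atTop (max L₀ 1))] with j hj
  have hL1 : 1 ≤ Ls j := le_trans (le_max_right _ _) hj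
  haveI : NeZero (Ls j) := ⟨by omega⟩
  have hInj1 : Set.InjOn (Torus.proj (d := 2) (Ls j)) ↑(thicken Λ 1) := hL₀ _ (le_trans (le_max_left _ _) hj)
  have hInj : Set.InjOn (Torus.proj (d := 2) (Ls j)) ↑Λ := hInj1.mono (by exact_mod_cast subset_thicken Λ 1)
  rw [torusAvgExpect_eq]
  refine re_torusAvgExpectAt_nonpos_of_forall hInj _ _ fun v => ?_
  have hGS := isGroundState_fockTranslate_mulVec t U v (hψ j)
  have hadj : (fermionTorusGraph 2 (Ls j)).Adj (FermionTorus.ofTorusSite (Torus.proj (Ls j) x))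
      (FermionTorus.ofTorusSite (Torus.proj (Ls j) y)) :=
    (fermionTorusGraph_adj_ofTorusSite_proj_iff (Ls j) hInj1 hx hy).2 hxy
  have hsign := hubbardTorus_re_expect_fermionSpinDot_nonpos_of_adj (hev j) ht hU hGS.1 hGS.2.2 hadj
  rw [fermionEmbed_toTorusEmb_spinDotAt]
  exact hsign

/-- **The Shen–Qiu–Tian sign rule in infinite volume — diagonal (next-nearest) neighbours are
positively correlated.** Under the hypotheses of `re_expect_spinDotAt_nonpos_of_adj`, for `x, y ∈ Λ`
with `y = x + (±e₁ ± e₂)` (`diagVec`): `0 ≤ Re ω_Λ(𝐒_x·𝐒_y)`.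
[cite: ShenQiuTian1994, Theorem and eqs. (7)–(9)] [cite: BratteliRobinsonI1987, §4.3.1] -/
theorem InfVolFermionState.IsTorusLimitOf.re_expect_spinDotAt_nonneg_of_diag {t U : ℝ} (ht : t ≠ 0)
    (hU : 0 < U) {Ls : ℕ → ℕ} (hLs : Tendsto Ls atTop atTop) (hev : ∀ j, Even (Ls j))
    {ψ : ∀ L, Fock (Orb (FermionTorus 2 L))}
    (hψ : ∀ j, _root_.Literature.MathematicalPhysics.QuantumLattice.IsGroundState
      (hamiltonian (fermionTorusGraph 2 (Ls j)) t U) (Ls j ^ 2) (ψ (Ls j)))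
    {ω : InfVolFermionState 2} (hω : ω.IsTorusLimitOf ψ Ls)
    {Λ : Finset (Site 2)} {x y : Site 2} (hx : x ∈ Λ) (hy : y ∈ Λ)
    (hxy : (∃ s : Fin 2, y = x + diagVec s) ∨ ∃ s : Fin 2, x = y + diagVec s) :
    0 ≤ (ω.expect Λ (spinDotAt x hx y hy)).re := by
  refine hω.re_expect_nonneg_of_eventually (spinDotAt x hx y hy) ?_
  obtain ⟨L₀, hL₀⟩ := exists_forall_le_injOn_proj (thicken Λ 1)
  filter_upwards [hLs.eventually (eventually_ge_atTop (max L₀ 1))] with j hj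
  have hL1 : 1 ≤ Ls j := le_trans (le_max_right _ _) hj
  haveI : NeZero (Ls j) := ⟨by omega⟩
  have hInj1 : Set.InjOn (Torus.proj (d := 2) (Ls j)) ↑(thicken Λ 1) := hL₀ _ (le_trans (le_max_left _ _) hj)
  have hInj : Set.InjOn (Torus.proj (d := 2) (Ls j)) ↑Λ := hInj1.mono (by exact_mod_cast subset_thicken Λ 1)
  rw [torusAvgExpect_eq]
  refine re_torusAvgExpectAt_nonneg_of_forall hInj _ _ fun v => ?_
  have hGS := isGroundState_fockTranslate_mulVec t U v (hψ j)
  have hadj : (fermionTorusDiagGraph (Ls j)).Adj (FermionTorus.ofTorusSite (Torus.proj (Ls j) x))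
      (FermionTorus.ofTorusSite (Torus.proj (Ls j) y)) :=
    (fermionTorusDiagGraph_adj_ofTorusSite_proj_iff (Ls j) hInj1 hx hy).2 hxy
  have hsign := hubbardTorus_re_expect_fermionSpinDot_nonneg_of_diagAdj (hev j) ht hU hGS.1 hGS.2.2 hadj
  rw [fermionEmbed_toTorusEmb_spinDotAt]
  exact hsign

/-! ### §4 The supports of the bundle's spin rows -/

/-- `0` and `e_i` are nearest neighbours in `ℤ²`. [cite: FriedliVelenik2017, §3.1] -/
theorem zdGraph_adj_zero_unitVec (i : Fin 2) : (zdGraph 2).Adj (0 : Site 2) (unitVec i) :=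
  (zdGraph_adj_iff _ _).2 ⟨i, Or.inl (by rw [zero_add])⟩

/-- `e₁ + e₂` is the diagonal vector `diagVec 0` and `e₁ - e₂` is `diagVec 1`. [folklore] -/
private theorem unitVec_add_unitVec_eq_diagVec :
    (unitVec 0 + unitVec 1 : Site 2) = diagVec 0 ∧ (unitVec 0 - unitVec 1 : Site 2) = diagVec 1 := by
  constructor <;> (funext i; fin_cases i <;> simp [unitVec, diagVec])

/-- `0 ∈ {0, e₁, e₂}`. [folklore] -/
private theorem zero_mem_nnWindow : (0 : Site 2) ∈ ({0, unitVec 0, unitVec 1} : Finset (Site 2)) :=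
  mem_insert_self _ _

/-- `e_i ∈ {0, e₁, e₂}`. [folklore] -/
private theorem unitVec_mem_nnWindow (i : Fin 2) : unitVec i ∈ ({0, unitVec 0, unitVec 1} : Finset (Site 2)) := by
  fin_cases i
  · exact mem_insert_of_mem (mem_insert_self _ _)
  · exact mem_insert_of_mem (mem_insert_of_mem (mem_singleton_self _))

/-- `0 ∈ {0, e₁+e₂, e₁-e₂}`. [folklore] -/
private theorem zero_mem_nnnWindow :
    (0 : Site 2) ∈ ({0, unitVec 0 + unitVec 1, unitVec 0 - unitVec 1} : Finset (Site 2)) :=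
  mem_insert_self _ _

/-- `e₁+e₂ ∈ {0, e₁+e₂, e₁-e₂}`. [folklore] -/
private theorem add_mem_nnnWindow :
    (unitVec 0 + unitVec 1 : Site 2) ∈ ({0, unitVec 0 + unitVec 1, unitVec 0 - unitVec 1} : Finset (Site 2)) :=
  mem_insert_of_mem (mem_insert_self _ _)

/-- `e₁-e₂ ∈ {0, e₁+e₂, e₁-e₂}`. [folklore] -/
private theorem sub_mem_nnnWindow :
    (unitVec 0 - unitVec 1 : Site 2) ∈ ({0, unitVec 0 + unitVec 1, unitVec 0 - unitVec 1} : Finset (Site 2)) :=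
  mem_insert_of_mem (mem_insert_of_mem (mem_singleton_self _))

/-- **The bond-summed nearest-neighbour spin correlation of every torus-limit half-filled ground state
is `≤ 0`**: on the support `{0, e₁, e₂}` of the bundle's `spin_nn` objective,
`Re ω(𝐒_0·𝐒_{e₁} + 𝐒_0·𝐒_{e₂}) ≤ 0` for every torus-limit half-filled ground state `ω` of the square
lattice (`t ≠ 0`, `U > 0`, even `L → ∞`); any membership proofs. This is the SIGN half of the
bundle's certified intervals `C₁(U) ≤ -c(U) < 0`, valid at every `U > 0` without a certificate.
[cite: ShenQiuTian1994, Theorem and eqs. (7)–(9)] -/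
theorem InfVolFermionState.IsTorusLimitOf.re_expect_sum_spinDotAt_unitVec_nonpos {t U : ℝ} (ht : t ≠ 0)
    (hU : 0 < U) {Ls : ℕ → ℕ} (hLs : Tendsto Ls atTop atTop) (hev : ∀ j, Even (Ls j))
    {ψ : ∀ L, Fock (Orb (FermionTorus 2 L))}
    (hψ : ∀ j, _root_.Literature.MathematicalPhysics.QuantumLattice.IsGroundState
      (hamiltonian (fermionTorusGraph 2 (Ls j)) t U) (Ls j ^ 2) (ψ (Ls j)))
    {ω : InfVolFermionState 2} (hω : ω.IsTorusLimitOf ψ Ls)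
    (h0 : (0 : Site 2) ∈ ({0, unitVec 0, unitVec 1} : Finset (Site 2)))
    (hi : ∀ i : Fin 2, unitVec i ∈ ({0, unitVec 0, unitVec 1} : Finset (Site 2))) :
    (ω.expect ({0, unitVec 0, unitVec 1} : Finset (Site 2))
        (∑ i : Fin 2, spinDotAt 0 h0 (unitVec i) (hi i))).re ≤ 0 := by
  rw [map_sum, Complex.re_sum]
  exact Finset.sum_nonpos fun i _ =>
    hω.re_expect_spinDotAt_nonpos_of_adj ht hU hLs hev hψ h0 (hi i) (zdGraph_adj_zero_unitVec i)

/-- **The diagonal-summed next-nearest-neighbour spin correlation of every torus-limit half-filled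
ground state is `≥ 0`**: on the support `{0, e₁+e₂, e₁-e₂}` of the bundle's `spin_nnn` objective,
`0 ≤ Re ω(𝐒_0·𝐒_{e₁+e₂} + 𝐒_0·𝐒_{e₁-e₂})` (`t ≠ 0`, `U > 0`, even `L → ∞`); any membership proofs.
[cite: ShenQiuTian1994, Theorem and eqs. (7)–(9)] -/
theorem InfVolFermionState.IsTorusLimitOf.re_expect_sum_spinDotAt_diag_nonneg {t U : ℝ} (ht : t ≠ 0)
    (hU : 0 < U) {Ls : ℕ → ℕ} (hLs : Tendsto Ls atTop atTop) (hev : ∀ j, Even (Ls j))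
    {ψ : ∀ L, Fock (Orb (FermionTorus 2 L))}
    (hψ : ∀ j, _root_.Literature.MathematicalPhysics.QuantumLattice.IsGroundState
      (hamiltonian (fermionTorusGraph 2 (Ls j)) t U) (Ls j ^ 2) (ψ (Ls j)))
    {ω : InfVolFermionState 2} (hω : ω.IsTorusLimitOf ψ Ls)
    (h0 : (0 : Site 2) ∈ ({0, unitVec 0 + unitVec 1, unitVec 0 - unitVec 1} : Finset (Site 2)))
    (hp : (unitVec 0 + unitVec 1 : Site 2) ∈ ({0, unitVec 0 + unitVec 1, unitVec 0 - unitVec 1} : Finset (Site 2)))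
    (hm : (unitVec 0 - unitVec 1 : Site 2) ∈ ({0, unitVec 0 + unitVec 1, unitVec 0 - unitVec 1} : Finset (Site 2))) :
    0 ≤ (ω.expect ({0, unitVec 0 + unitVec 1, unitVec 0 - unitVec 1} : Finset (Site 2))
        (spinDotAt 0 h0 (unitVec 0 + unitVec 1) hp + spinDotAt 0 h0 (unitVec 0 - unitVec 1) hm)).re := by
  obtain ⟨hadd, hsub⟩ := unitVec_add_unitVec_eq_diagVec
  rw [map_add, Complex.add_re]
  refine add_nonneg ?_ ?_
  · exact hω.re_expect_spinDotAt_nonneg_of_diag ht hU hLs hev hψ h0 hp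
      (Or.inl ⟨0, by rw [zero_add]; exact hadd⟩)
  · exact hω.re_expect_spinDotAt_nonneg_of_diag ht hU hLs hev hψ h0 hm
      (Or.inl ⟨1, by rw [zero_add]; exact hsub⟩)

/-- **Non-vacuity**: torus-limit half-filled ground states exist (compactness,
`LiebHalfFilled.exists_isTorusLimitOf_groundState`), and every one of them has antiferromagnetic
nearest-neighbour spin correlations. [cite: ShenQiuTian1994, Theorem and eqs. (7)–(9)] -/
theorem exists_isTorusLimitOf_re_expect_sum_spinDotAt_unitVec_nonpos {t U : ℝ} (ht : t ≠ 0) (hU : 0 < U) :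
    ∃ (ω : InfVolFermionState 2) (Ls : ℕ → ℕ) (ψ : ∀ L, Fock (Orb (FermionTorus 2 L))),
      Tendsto Ls atTop atTop ∧ (∀ j, Even (Ls j)) ∧
      (∀ j, IsGroundState (hamiltonian (fermionTorusGraph 2 (Ls j)) t U) (Ls j ^ 2) (ψ (Ls j))) ∧
      ω.IsTorusLimitOf ψ Ls ∧
      (ω.expect ({0, unitVec 0, unitVec 1} : Finset (Site 2))
        (∑ i : Fin 2, spinDotAt 0 zero_mem_nnWindow (unitVec i) (unitVec_mem_nnWindow i))).re ≤ 0 := by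
  obtain ⟨Ls, ψ, ω, hLs, hev, hψ, -, hω⟩ := LiebHalfFilled.exists_isTorusLimitOf_groundState ht hU
  exact ⟨ω, Ls, ψ, hLs, hev, hψ, hω,
    hω.re_expect_sum_spinDotAt_unitVec_nonpos ht hU hLs hev hψ zero_mem_nnWindow unitVec_mem_nnWindow⟩

/-! ### §5 The bundle's spin rows, literally

The typed `spin_nn` / `spin_nnn` rows of the bundle (format `certsdp/1` §6) state their conclusion on
the LIST of twelve normal-ordered words of `λ·½ Σ 𝐒_0·𝐒_y` (`y = e₂, e₁` resp. `y = e₁-e₂, e₁+e₂`,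
`λ = ±1`), in a fixed order and bracketing, with rational coefficients `±1/8, ±1/4`. The identities
below recognise those polynomials as `(λ/2) • (𝐒_0·𝐒_{y₂} + 𝐒_0·𝐒_{y₁})` (normal-ordered expansion
`spinDotAt_eq_normalOrder`) and restate §3–§4 on them, so that a typed row and the sign theorem speak
about literally the same number. Membership proofs are binders (any choice, by proof irrelevance). -/

/-- `0 ≠ e_i` in `ℤ²`. [folklore] -/
private theorem zero_ne_unitVec (i : Fin 2) : (0 : Site 2) ≠ unitVec i := by
  intro h
  have h' := congrFun h i
  simp [unitVec] at h'

/-- `0 ≠ e₁ + e₂` and `0 ≠ e₁ - e₂` in `ℤ²`. [folklore] -/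
private theorem zero_ne_diag :
    (0 : Site 2) ≠ unitVec 0 + unitVec 1 ∧ (0 : Site 2) ≠ unitVec 0 - unitVec 1 := by
  constructor <;> (intro h; have h' := congrFun h 0; simp [unitVec] at h')

/-- The `spin_nn` row polynomial with `λ = 1` is `½ (𝐒_0·𝐒_{e₂} + 𝐒_0·𝐒_{e₁})`. [cite: EsslerEtAl2005, §2.1 eq. (2.2) and §2.2.5 eq. (2.66)] -/
private theorem spinWords_nn_plus_eq
    (h0 : (0 : Site 2) ∈ ({0, unitVec 0, unitVec 1} : Finset (Site 2)))
    (hi : ∀ i : Fin 2, unitVec i ∈ ({0, unitVec 0, unitVec 1} : Finset (Site 2))) :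
    (((1/8 : ℚ) : ℂ) • ((cAt 0 h0 0)ᴴ * (cAt (unitVec 1) (hi 1) 0)ᴴ * cAt (unitVec 1) (hi 1) 0 * cAt 0 h0 0) +
      ((1/4 : ℚ) : ℂ) • ((cAt 0 h0 0)ᴴ * (cAt (unitVec 1) (hi 1) 1)ᴴ * cAt (unitVec 1) (hi 1) 0 * cAt 0 h0 1) +
      ((-1/8 : ℚ) : ℂ) • ((cAt 0 h0 0)ᴴ * (cAt (unitVec 1) (hi 1) 1)ᴴ * cAt (unitVec 1) (hi 1) 1 * cAt 0 h0 0) +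
      ((1/8 : ℚ) : ℂ) • ((cAt 0 h0 0)ᴴ * (cAt (unitVec 0) (hi 0) 0)ᴴ * cAt (unitVec 0) (hi 0) 0 * cAt 0 h0 0) +
      ((1/4 : ℚ) : ℂ) • ((cAt 0 h0 0)ᴴ * (cAt (unitVec 0) (hi 0) 1)ᴴ * cAt (unitVec 0) (hi 0) 0 * cAt 0 h0 1) +
      ((-1/8 : ℚ) : ℂ) • ((cAt 0 h0 0)ᴴ * (cAt (unitVec 0) (hi 0) 1)ᴴ * cAt (unitVec 0) (hi 0) 1 * cAt 0 h0 0) +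
      ((-1/8 : ℚ) : ℂ) • ((cAt 0 h0 1)ᴴ * (cAt (unitVec 1) (hi 1) 0)ᴴ * cAt (unitVec 1) (hi 1) 0 * cAt 0 h0 1) +
      ((1/4 : ℚ) : ℂ) • ((cAt 0 h0 1)ᴴ * (cAt (unitVec 1) (hi 1) 0)ᴴ * cAt (unitVec 1) (hi 1) 1 * cAt 0 h0 0) +
      ((1/8 : ℚ) : ℂ) • ((cAt 0 h0 1)ᴴ * (cAt (unitVec 1) (hi 1) 1)ᴴ * cAt (unitVec 1) (hi 1) 1 * cAt 0 h0 1) +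
      ((-1/8 : ℚ) : ℂ) • ((cAt 0 h0 1)ᴴ * (cAt (unitVec 0) (hi 0) 0)ᴴ * cAt (unitVec 0) (hi 0) 0 * cAt 0 h0 1) +
      ((1/4 : ℚ) : ℂ) • ((cAt 0 h0 1)ᴴ * (cAt (unitVec 0) (hi 0) 0)ᴴ * cAt (unitVec 0) (hi 0) 1 * cAt 0 h0 0) +
      ((1/8 : ℚ) : ℂ) • ((cAt 0 h0 1)ᴴ * (cAt (unitVec 0) (hi 0) 1)ᴴ * cAt (unitVec 0) (hi 0) 1 * cAt 0 h0 1)) =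
      ((1 / 2 : ℂ)) • (spinDotAt 0 h0 (unitVec 1) (hi 1) + spinDotAt 0 h0 (unitVec 0) (hi 0)) := by
  rw [spinDotAt_eq_normalOrder (zero_ne_unitVec 1), spinDotAt_eq_normalOrder (zero_ne_unitVec 0)]
  push_cast
  module

/-- The `spin_nn` row polynomial with `λ = -1` is `-½ (𝐒_0·𝐒_{e₂} + 𝐒_0·𝐒_{e₁})`. [cite: EsslerEtAl2005, §2.1 eq. (2.2) and §2.2.5 eq. (2.66)] -/
private theorem spinWords_nn_minus_eq
    (h0 : (0 : Site 2) ∈ ({0, unitVec 0, unitVec 1} : Finset (Site 2)))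
    (hi : ∀ i : Fin 2, unitVec i ∈ ({0, unitVec 0, unitVec 1} : Finset (Site 2))) :
    (((-1/8 : ℚ) : ℂ) • ((cAt 0 h0 0)ᴴ * (cAt (unitVec 1) (hi 1) 0)ᴴ * cAt (unitVec 1) (hi 1) 0 * cAt 0 h0 0) +
      ((-1/4 : ℚ) : ℂ) • ((cAt 0 h0 0)ᴴ * (cAt (unitVec 1) (hi 1) 1)ᴴ * cAt (unitVec 1) (hi 1) 0 * cAt 0 h0 1) +
      ((1/8 : ℚ) : ℂ) • ((cAt 0 h0 0)ᴴ * (cAt (unitVec 1) (hi 1) 1)ᴴ * cAt (unitVec 1) (hi 1) 1 * cAt 0 h0 0) +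
      ((-1/8 : ℚ) : ℂ) • ((cAt 0 h0 0)ᴴ * (cAt (unitVec 0) (hi 0) 0)ᴴ * cAt (unitVec 0) (hi 0) 0 * cAt 0 h0 0) +
      ((-1/4 : ℚ) : ℂ) • ((cAt 0 h0 0)ᴴ * (cAt (unitVec 0) (hi 0) 1)ᴴ * cAt (unitVec 0) (hi 0) 0 * cAt 0 h0 1) +
      ((1/8 : ℚ) : ℂ) • ((cAt 0 h0 0)ᴴ * (cAt (unitVec 0) (hi 0) 1)ᴴ * cAt (unitVec 0) (hi 0) 1 * cAt 0 h0 0) +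
      ((1/8 : ℚ) : ℂ) • ((cAt 0 h0 1)ᴴ * (cAt (unitVec 1) (hi 1) 0)ᴴ * cAt (unitVec 1) (hi 1) 0 * cAt 0 h0 1) +
      ((-1/4 : ℚ) : ℂ) • ((cAt 0 h0 1)ᴴ * (cAt (unitVec 1) (hi 1) 0)ᴴ * cAt (unitVec 1) (hi 1) 1 * cAt 0 h0 0) +
      ((-1/8 : ℚ) : ℂ) • ((cAt 0 h0 1)ᴴ * (cAt (unitVec 1) (hi 1) 1)ᴴ * cAt (unitVec 1) (hi 1) 1 * cAt 0 h0 1) +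
      ((1/8 : ℚ) : ℂ) • ((cAt 0 h0 1)ᴴ * (cAt (unitVec 0) (hi 0) 0)ᴴ * cAt (unitVec 0) (hi 0) 0 * cAt 0 h0 1) +
      ((-1/4 : ℚ) : ℂ) • ((cAt 0 h0 1)ᴴ * (cAt (unitVec 0) (hi 0) 0)ᴴ * cAt (unitVec 0) (hi 0) 1 * cAt 0 h0 0) +
      ((-1/8 : ℚ) : ℂ) • ((cAt 0 h0 1)ᴴ * (cAt (unitVec 0) (hi 0) 1)ᴴ * cAt (unitVec 0) (hi 0) 1 * cAt 0 h0 1)) =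
      ((-1 / 2 : ℂ)) • (spinDotAt 0 h0 (unitVec 1) (hi 1) + spinDotAt 0 h0 (unitVec 0) (hi 0)) := by
  rw [spinDotAt_eq_normalOrder (zero_ne_unitVec 1), spinDotAt_eq_normalOrder (zero_ne_unitVec 0)]
  push_cast
  module

/-- The `spin_nnn` row polynomial with `λ = 1` is `½ (𝐒_0·𝐒_{e₁-e₂} + 𝐒_0·𝐒_{e₁+e₂})`. [cite: EsslerEtAl2005, §2.1 eq. (2.2) and §2.2.5 eq. (2.66)] -/
private theorem spinWords_nnn_plus_eq
    (h0 : (0 : Site 2) ∈ ({0, unitVec 0 + unitVec 1, unitVec 0 - unitVec 1} : Finset (Site 2)))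
    (hp : (unitVec 0 + unitVec 1 : Site 2) ∈ ({0, unitVec 0 + unitVec 1, unitVec 0 - unitVec 1} : Finset (Site 2)))
    (hm : (unitVec 0 - unitVec 1 : Site 2) ∈ ({0, unitVec 0 + unitVec 1, unitVec 0 - unitVec 1} : Finset (Site 2))) :
    (((1/8 : ℚ) : ℂ) • ((cAt 0 h0 0)ᴴ * (cAt (unitVec 0 - unitVec 1) hm 0)ᴴ * cAt (unitVec 0 - unitVec 1) hm 0 * cAt 0 h0 0) +
      ((1/4 : ℚ) : ℂ) • ((cAt 0 h0 0)ᴴ * (cAt (unitVec 0 - unitVec 1) hm 1)ᴴ * cAt (unitVec 0 - unitVec 1) hm 0 * cAt 0 h0 1) +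
      ((-1/8 : ℚ) : ℂ) • ((cAt 0 h0 0)ᴴ * (cAt (unitVec 0 - unitVec 1) hm 1)ᴴ * cAt (unitVec 0 - unitVec 1) hm 1 * cAt 0 h0 0) +
      ((1/8 : ℚ) : ℂ) • ((cAt 0 h0 0)ᴴ * (cAt (unitVec 0 + unitVec 1) hp 0)ᴴ * cAt (unitVec 0 + unitVec 1) hp 0 * cAt 0 h0 0) +
      ((1/4 : ℚ) : ℂ) • ((cAt 0 h0 0)ᴴ * (cAt (unitVec 0 + unitVec 1) hp 1)ᴴ * cAt (unitVec 0 + unitVec 1) hp 0 * cAt 0 h0 1) +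
      ((-1/8 : ℚ) : ℂ) • ((cAt 0 h0 0)ᴴ * (cAt (unitVec 0 + unitVec 1) hp 1)ᴴ * cAt (unitVec 0 + unitVec 1) hp 1 * cAt 0 h0 0) +
      ((-1/8 : ℚ) : ℂ) • ((cAt 0 h0 1)ᴴ * (cAt (unitVec 0 - unitVec 1) hm 0)ᴴ * cAt (unitVec 0 - unitVec 1) hm 0 * cAt 0 h0 1) +
      ((1/4 : ℚ) : ℂ) • ((cAt 0 h0 1)ᴴ * (cAt (unitVec 0 - unitVec 1) hm 0)ᴴ * cAt (unitVec 0 - unitVec 1) hm 1 * cAt 0 h0 0) +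
      ((1/8 : ℚ) : ℂ) • ((cAt 0 h0 1)ᴴ * (cAt (unitVec 0 - unitVec 1) hm 1)ᴴ * cAt (unitVec 0 - unitVec 1) hm 1 * cAt 0 h0 1) +
      ((-1/8 : ℚ) : ℂ) • ((cAt 0 h0 1)ᴴ * (cAt (unitVec 0 + unitVec 1) hp 0)ᴴ * cAt (unitVec 0 + unitVec 1) hp 0 * cAt 0 h0 1) +
      ((1/4 : ℚ) : ℂ) • ((cAt 0 h0 1)ᴴ * (cAt (unitVec 0 + unitVec 1) hp 0)ᴴ * cAt (unitVec 0 + unitVec 1) hp 1 * cAt 0 h0 0) +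
      ((1/8 : ℚ) : ℂ) • ((cAt 0 h0 1)ᴴ * (cAt (unitVec 0 + unitVec 1) hp 1)ᴴ * cAt (unitVec 0 + unitVec 1) hp 1 * cAt 0 h0 1)) =
      ((1 / 2 : ℂ)) • (spinDotAt 0 h0 (unitVec 0 - unitVec 1) hm + spinDotAt 0 h0 (unitVec 0 + unitVec 1) hp) := by
  rw [spinDotAt_eq_normalOrder zero_ne_diag.2, spinDotAt_eq_normalOrder zero_ne_diag.1]
  push_cast
  module

/-- The `spin_nnn` row polynomial with `λ = -1` is `-½ (𝐒_0·𝐒_{e₁-e₂} + 𝐒_0·𝐒_{e₁+e₂})`. [cite: EsslerEtAl2005, §2.1 eq. (2.2) and §2.2.5 eq. (2.66)] -/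
private theorem spinWords_nnn_minus_eq
    (h0 : (0 : Site 2) ∈ ({0, unitVec 0 + unitVec 1, unitVec 0 - unitVec 1} : Finset (Site 2)))
    (hp : (unitVec 0 + unitVec 1 : Site 2) ∈ ({0, unitVec 0 + unitVec 1, unitVec 0 - unitVec 1} : Finset (Site 2)))
    (hm : (unitVec 0 - unitVec 1 : Site 2) ∈ ({0, unitVec 0 + unitVec 1, unitVec 0 - unitVec 1} : Finset (Site 2))) :
    (((-1/8 : ℚ) : ℂ) • ((cAt 0 h0 0)ᴴ * (cAt (unitVec 0 - unitVec 1) hm 0)ᴴ * cAt (unitVec 0 - unitVec 1) hm 0 * cAt 0 h0 0) +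
      ((-1/4 : ℚ) : ℂ) • ((cAt 0 h0 0)ᴴ * (cAt (unitVec 0 - unitVec 1) hm 1)ᴴ * cAt (unitVec 0 - unitVec 1) hm 0 * cAt 0 h0 1) +
      ((1/8 : ℚ) : ℂ) • ((cAt 0 h0 0)ᴴ * (cAt (unitVec 0 - unitVec 1) hm 1)ᴴ * cAt (unitVec 0 - unitVec 1) hm 1 * cAt 0 h0 0) +
      ((-1/8 : ℚ) : ℂ) • ((cAt 0 h0 0)ᴴ * (cAt (unitVec 0 + unitVec 1) hp 0)ᴴ * cAt (unitVec 0 + unitVec 1) hp 0 * cAt 0 h0 0) +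
      ((-1/4 : ℚ) : ℂ) • ((cAt 0 h0 0)ᴴ * (cAt (unitVec 0 + unitVec 1) hp 1)ᴴ * cAt (unitVec 0 + unitVec 1) hp 0 * cAt 0 h0 1) +
      ((1/8 : ℚ) : ℂ) • ((cAt 0 h0 0)ᴴ * (cAt (unitVec 0 + unitVec 1) hp 1)ᴴ * cAt (unitVec 0 + unitVec 1) hp 1 * cAt 0 h0 0) +
      ((1/8 : ℚ) : ℂ) • ((cAt 0 h0 1)ᴴ * (cAt (unitVec 0 - unitVec 1) hm 0)ᴴ * cAt (unitVec 0 - unitVec 1) hm 0 * cAt 0 h0 1) +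
      ((-1/4 : ℚ) : ℂ) • ((cAt 0 h0 1)ᴴ * (cAt (unitVec 0 - unitVec 1) hm 0)ᴴ * cAt (unitVec 0 - unitVec 1) hm 1 * cAt 0 h0 0) +
      ((-1/8 : ℚ) : ℂ) • ((cAt 0 h0 1)ᴴ * (cAt (unitVec 0 - unitVec 1) hm 1)ᴴ * cAt (unitVec 0 - unitVec 1) hm 1 * cAt 0 h0 1) +
      ((1/8 : ℚ) : ℂ) • ((cAt 0 h0 1)ᴴ * (cAt (unitVec 0 + unitVec 1) hp 0)ᴴ * cAt (unitVec 0 + unitVec 1) hp 0 * cAt 0 h0 1) +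
      ((-1/4 : ℚ) : ℂ) • ((cAt 0 h0 1)ᴴ * (cAt (unitVec 0 + unitVec 1) hp 0)ᴴ * cAt (unitVec 0 + unitVec 1) hp 1 * cAt 0 h0 0) +
      ((-1/8 : ℚ) : ℂ) • ((cAt 0 h0 1)ᴴ * (cAt (unitVec 0 + unitVec 1) hp 1)ᴴ * cAt (unitVec 0 + unitVec 1) hp 1 * cAt 0 h0 1)) =
      ((-1 / 2 : ℂ)) • (spinDotAt 0 h0 (unitVec 0 - unitVec 1) hm + spinDotAt 0 h0 (unitVec 0 + unitVec 1) hp) := by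
  rw [spinDotAt_eq_normalOrder zero_ne_diag.2, spinDotAt_eq_normalOrder zero_ne_diag.1]
  push_cast
  module

/-- **A `spin_nn` row with `λ = 1` bounds a non-positive number**: for every torus-limit half-filled ground state `ω` of the square lattice (`t ≠ 0`, `U > 0`, even `L → ∞`) the row polynomial `½ Σ_i 𝐒_0·𝐒_{e_i}`, written as the bundle's twelve words, has `Re ω(·) ≤ 0`. [cite: ShenQiuTian1994, Theorem and eqs. (7)–(9)] -/
theorem InfVolFermionState.IsTorusLimitOf.re_expect_spinWords_nn_plus_nonpos {t U : ℝ} (ht : t ≠ 0)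
    (hU : 0 < U) {Ls : ℕ → ℕ} (hLs : Tendsto Ls atTop atTop) (hev : ∀ j, Even (Ls j))
    {ψ : ∀ L, Fock (Orb (FermionTorus 2 L))}
    (hψ : ∀ j, _root_.Literature.MathematicalPhysics.QuantumLattice.IsGroundState
      (hamiltonian (fermionTorusGraph 2 (Ls j)) t U) (Ls j ^ 2) (ψ (Ls j)))
    {ω : InfVolFermionState 2} (hω : ω.IsTorusLimitOf ψ Ls)
    (h0 : (0 : Site 2) ∈ ({0, unitVec 0, unitVec 1} : Finset (Site 2)))
    (hi : ∀ i : Fin 2, unitVec i ∈ ({0, unitVec 0, unitVec 1} : Finset (Site 2))) :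
    (ω.expect ({0, unitVec 0, unitVec 1} : Finset (Site 2))
        (((1/8 : ℚ) : ℂ) • ((cAt 0 h0 0)ᴴ * (cAt (unitVec 1) (hi 1) 0)ᴴ * cAt (unitVec 1) (hi 1) 0 * cAt 0 h0 0) +
        ((1/4 : ℚ) : ℂ) • ((cAt 0 h0 0)ᴴ * (cAt (unitVec 1) (hi 1) 1)ᴴ * cAt (unitVec 1) (hi 1) 0 * cAt 0 h0 1) +
        ((-1/8 : ℚ) : ℂ) • ((cAt 0 h0 0)ᴴ * (cAt (unitVec 1) (hi 1) 1)ᴴ * cAt (unitVec 1) (hi 1) 1 * cAt 0 h0 0) +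
        ((1/8 : ℚ) : ℂ) • ((cAt 0 h0 0)ᴴ * (cAt (unitVec 0) (hi 0) 0)ᴴ * cAt (unitVec 0) (hi 0) 0 * cAt 0 h0 0) +
        ((1/4 : ℚ) : ℂ) • ((cAt 0 h0 0)ᴴ * (cAt (unitVec 0) (hi 0) 1)ᴴ * cAt (unitVec 0) (hi 0) 0 * cAt 0 h0 1) +
        ((-1/8 : ℚ) : ℂ) • ((cAt 0 h0 0)ᴴ * (cAt (unitVec 0) (hi 0) 1)ᴴ * cAt (unitVec 0) (hi 0) 1 * cAt 0 h0 0) +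
        ((-1/8 : ℚ) : ℂ) • ((cAt 0 h0 1)ᴴ * (cAt (unitVec 1) (hi 1) 0)ᴴ * cAt (unitVec 1) (hi 1) 0 * cAt 0 h0 1) +
        ((1/4 : ℚ) : ℂ) • ((cAt 0 h0 1)ᴴ * (cAt (unitVec 1) (hi 1) 0)ᴴ * cAt (unitVec 1) (hi 1) 1 * cAt 0 h0 0) +
        ((1/8 : ℚ) : ℂ) • ((cAt 0 h0 1)ᴴ * (cAt (unitVec 1) (hi 1) 1)ᴴ * cAt (unitVec 1) (hi 1) 1 * cAt 0 h0 1) +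
        ((-1/8 : ℚ) : ℂ) • ((cAt 0 h0 1)ᴴ * (cAt (unitVec 0) (hi 0) 0)ᴴ * cAt (unitVec 0) (hi 0) 0 * cAt 0 h0 1) +
        ((1/4 : ℚ) : ℂ) • ((cAt 0 h0 1)ᴴ * (cAt (unitVec 0) (hi 0) 0)ᴴ * cAt (unitVec 0) (hi 0) 1 * cAt 0 h0 0) +
        ((1/8 : ℚ) : ℂ) • ((cAt 0 h0 1)ᴴ * (cAt (unitVec 0) (hi 0) 1)ᴴ * cAt (unitVec 0) (hi 0) 1 * cAt 0 h0 1))).re ≤ 0 := by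
  have h := hω.re_expect_sum_spinDotAt_unitVec_nonpos ht hU hLs hev hψ h0 hi
  rw [Fin.sum_univ_two, map_add, Complex.add_re] at h
  rw [spinWords_nn_plus_eq, map_smul, smul_eq_mul, show ((1 / 2 : ℂ)) = ((1 / 2 : ℝ) : ℂ) by push_cast; ring,
    Complex.re_ofReal_mul, map_add, Complex.add_re]
  linarith

/-- **A `spin_nn` row with `λ = -1` bounds a non-negative number**: `Re ω(-½ Σ_i 𝐒_0·𝐒_{e_i}) ≥ 0` for every torus-limit half-filled ground state `ω` (`t ≠ 0`, `U > 0`, even `L → ∞`), the polynomial written as the bundle's twelve words. [cite: ShenQiuTian1994, Theorem and eqs. (7)–(9)] -/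
theorem InfVolFermionState.IsTorusLimitOf.re_expect_spinWords_nn_minus_nonneg {t U : ℝ} (ht : t ≠ 0)
    (hU : 0 < U) {Ls : ℕ → ℕ} (hLs : Tendsto Ls atTop atTop) (hev : ∀ j, Even (Ls j))
    {ψ : ∀ L, Fock (Orb (FermionTorus 2 L))}
    (hψ : ∀ j, _root_.Literature.MathematicalPhysics.QuantumLattice.IsGroundState
      (hamiltonian (fermionTorusGraph 2 (Ls j)) t U) (Ls j ^ 2) (ψ (Ls j)))
    {ω : InfVolFermionState 2} (hω : ω.IsTorusLimitOf ψ Ls)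
    (h0 : (0 : Site 2) ∈ ({0, unitVec 0, unitVec 1} : Finset (Site 2)))
    (hi : ∀ i : Fin 2, unitVec i ∈ ({0, unitVec 0, unitVec 1} : Finset (Site 2))) :
    0 ≤ (ω.expect ({0, unitVec 0, unitVec 1} : Finset (Site 2))
        (((-1/8 : ℚ) : ℂ) • ((cAt 0 h0 0)ᴴ * (cAt (unitVec 1) (hi 1) 0)ᴴ * cAt (unitVec 1) (hi 1) 0 * cAt 0 h0 0) +
        ((-1/4 : ℚ) : ℂ) • ((cAt 0 h0 0)ᴴ * (cAt (unitVec 1) (hi 1) 1)ᴴ * cAt (unitVec 1) (hi 1) 0 * cAt 0 h0 1) +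
        ((1/8 : ℚ) : ℂ) • ((cAt 0 h0 0)ᴴ * (cAt (unitVec 1) (hi 1) 1)ᴴ * cAt (unitVec 1) (hi 1) 1 * cAt 0 h0 0) +
        ((-1/8 : ℚ) : ℂ) • ((cAt 0 h0 0)ᴴ * (cAt (unitVec 0) (hi 0) 0)ᴴ * cAt (unitVec 0) (hi 0) 0 * cAt 0 h0 0) +
        ((-1/4 : ℚ) : ℂ) • ((cAt 0 h0 0)ᴴ * (cAt (unitVec 0) (hi 0) 1)ᴴ * cAt (unitVec 0) (hi 0) 0 * cAt 0 h0 1) +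
        ((1/8 : ℚ) : ℂ) • ((cAt 0 h0 0)ᴴ * (cAt (unitVec 0) (hi 0) 1)ᴴ * cAt (unitVec 0) (hi 0) 1 * cAt 0 h0 0) +
        ((1/8 : ℚ) : ℂ) • ((cAt 0 h0 1)ᴴ * (cAt (unitVec 1) (hi 1) 0)ᴴ * cAt (unitVec 1) (hi 1) 0 * cAt 0 h0 1) +
        ((-1/4 : ℚ) : ℂ) • ((cAt 0 h0 1)ᴴ * (cAt (unitVec 1) (hi 1) 0)ᴴ * cAt (unitVec 1) (hi 1) 1 * cAt 0 h0 0) +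
        ((-1/8 : ℚ) : ℂ) • ((cAt 0 h0 1)ᴴ * (cAt (unitVec 1) (hi 1) 1)ᴴ * cAt (unitVec 1) (hi 1) 1 * cAt 0 h0 1) +
        ((1/8 : ℚ) : ℂ) • ((cAt 0 h0 1)ᴴ * (cAt (unitVec 0) (hi 0) 0)ᴴ * cAt (unitVec 0) (hi 0) 0 * cAt 0 h0 1) +
        ((-1/4 : ℚ) : ℂ) • ((cAt 0 h0 1)ᴴ * (cAt (unitVec 0) (hi 0) 0)ᴴ * cAt (unitVec 0) (hi 0) 1 * cAt 0 h0 0) +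
        ((-1/8 : ℚ) : ℂ) • ((cAt 0 h0 1)ᴴ * (cAt (unitVec 0) (hi 0) 1)ᴴ * cAt (unitVec 0) (hi 0) 1 * cAt 0 h0 1))).re := by
  have h := hω.re_expect_sum_spinDotAt_unitVec_nonpos ht hU hLs hev hψ h0 hi
  rw [Fin.sum_univ_two, map_add, Complex.add_re] at h
  rw [spinWords_nn_minus_eq, map_smul, smul_eq_mul, show ((-1 / 2 : ℂ)) = ((-1 / 2 : ℝ) : ℂ) by push_cast; ring,
    Complex.re_ofReal_mul, map_add, Complex.add_re]
  linarith

/-- **A `spin_nnn` row with `λ = 1` bounds a non-negative number**: `Re ω(½ (𝐒_0·𝐒_{e₁+e₂} + 𝐒_0·𝐒_{e₁-e₂})) ≥ 0` for every torus-limit half-filled ground state `ω` (`t ≠ 0`, `U > 0`, even `L → ∞`), the polynomial written as the bundle's twelve words. [cite: ShenQiuTian1994, Theorem and eqs. (7)–(9)] -/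
theorem InfVolFermionState.IsTorusLimitOf.re_expect_spinWords_nnn_plus_nonneg {t U : ℝ} (ht : t ≠ 0)
    (hU : 0 < U) {Ls : ℕ → ℕ} (hLs : Tendsto Ls atTop atTop) (hev : ∀ j, Even (Ls j))
    {ψ : ∀ L, Fock (Orb (FermionTorus 2 L))}
    (hψ : ∀ j, _root_.Literature.MathematicalPhysics.QuantumLattice.IsGroundState
      (hamiltonian (fermionTorusGraph 2 (Ls j)) t U) (Ls j ^ 2) (ψ (Ls j)))
    {ω : InfVolFermionState 2} (hω : ω.IsTorusLimitOf ψ Ls)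
    (h0 : (0 : Site 2) ∈ ({0, unitVec 0 + unitVec 1, unitVec 0 - unitVec 1} : Finset (Site 2)))
    (hp : (unitVec 0 + unitVec 1 : Site 2) ∈ ({0, unitVec 0 + unitVec 1, unitVec 0 - unitVec 1} : Finset (Site 2)))
    (hm : (unitVec 0 - unitVec 1 : Site 2) ∈ ({0, unitVec 0 + unitVec 1, unitVec 0 - unitVec 1} : Finset (Site 2))) :
    0 ≤ (ω.expect ({0, unitVec 0 + unitVec 1, unitVec 0 - unitVec 1} : Finset (Site 2))
        (((1/8 : ℚ) : ℂ) • ((cAt 0 h0 0)ᴴ * (cAt (unitVec 0 - unitVec 1) hm 0)ᴴ * cAt (unitVec 0 - unitVec 1) hm 0 * cAt 0 h0 0) +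
        ((1/4 : ℚ) : ℂ) • ((cAt 0 h0 0)ᴴ * (cAt (unitVec 0 - unitVec 1) hm 1)ᴴ * cAt (unitVec 0 - unitVec 1) hm 0 * cAt 0 h0 1) +
        ((-1/8 : ℚ) : ℂ) • ((cAt 0 h0 0)ᴴ * (cAt (unitVec 0 - unitVec 1) hm 1)ᴴ * cAt (unitVec 0 - unitVec 1) hm 1 * cAt 0 h0 0) +
        ((1/8 : ℚ) : ℂ) • ((cAt 0 h0 0)ᴴ * (cAt (unitVec 0 + unitVec 1) hp 0)ᴴ * cAt (unitVec 0 + unitVec 1) hp 0 * cAt 0 h0 0) +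
        ((1/4 : ℚ) : ℂ) • ((cAt 0 h0 0)ᴴ * (cAt (unitVec 0 + unitVec 1) hp 1)ᴴ * cAt (unitVec 0 + unitVec 1) hp 0 * cAt 0 h0 1) +
        ((-1/8 : ℚ) : ℂ) • ((cAt 0 h0 0)ᴴ * (cAt (unitVec 0 + unitVec 1) hp 1)ᴴ * cAt (unitVec 0 + unitVec 1) hp 1 * cAt 0 h0 0) +
        ((-1/8 : ℚ) : ℂ) • ((cAt 0 h0 1)ᴴ * (cAt (unitVec 0 - unitVec 1) hm 0)ᴴ * cAt (unitVec 0 - unitVec 1) hm 0 * cAt 0 h0 1) +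
        ((1/4 : ℚ) : ℂ) • ((cAt 0 h0 1)ᴴ * (cAt (unitVec 0 - unitVec 1) hm 0)ᴴ * cAt (unitVec 0 - unitVec 1) hm 1 * cAt 0 h0 0) +
        ((1/8 : ℚ) : ℂ) • ((cAt 0 h0 1)ᴴ * (cAt (unitVec 0 - unitVec 1) hm 1)ᴴ * cAt (unitVec 0 - unitVec 1) hm 1 * cAt 0 h0 1) +
        ((-1/8 : ℚ) : ℂ) • ((cAt 0 h0 1)ᴴ * (cAt (unitVec 0 + unitVec 1) hp 0)ᴴ * cAt (unitVec 0 + unitVec 1) hp 0 * cAt 0 h0 1) +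
        ((1/4 : ℚ) : ℂ) • ((cAt 0 h0 1)ᴴ * (cAt (unitVec 0 + unitVec 1) hp 0)ᴴ * cAt (unitVec 0 + unitVec 1) hp 1 * cAt 0 h0 0) +
        ((1/8 : ℚ) : ℂ) • ((cAt 0 h0 1)ᴴ * (cAt (unitVec 0 + unitVec 1) hp 1)ᴴ * cAt (unitVec 0 + unitVec 1) hp 1 * cAt 0 h0 1))).re := by
  have h := hω.re_expect_sum_spinDotAt_diag_nonneg ht hU hLs hev hψ h0 hp hm
  rw [map_add, Complex.add_re] at h
  rw [spinWords_nnn_plus_eq, map_smul, smul_eq_mul, show ((1 / 2 : ℂ)) = ((1 / 2 : ℝ) : ℂ) by push_cast; ring,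
    Complex.re_ofReal_mul, map_add, Complex.add_re]
  linarith

/-- **A `spin_nnn` row with `λ = -1` bounds a non-positive number**: `Re ω(-½ (𝐒_0·𝐒_{e₁+e₂} + 𝐒_0·𝐒_{e₁-e₂})) ≤ 0` for every torus-limit half-filled ground state `ω` (`t ≠ 0`, `U > 0`, even `L → ∞`), the polynomial written as the bundle's twelve words. [cite: ShenQiuTian1994, Theorem and eqs. (7)–(9)] -/
theorem InfVolFermionState.IsTorusLimitOf.re_expect_spinWords_nnn_minus_nonpos {t U : ℝ} (ht : t ≠ 0)
    (hU : 0 < U) {Ls : ℕ → ℕ} (hLs : Tendsto Ls atTop atTop) (hev : ∀ j, Even (Ls j))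
    {ψ : ∀ L, Fock (Orb (FermionTorus 2 L))}
    (hψ : ∀ j, _root_.Literature.MathematicalPhysics.QuantumLattice.IsGroundState
      (hamiltonian (fermionTorusGraph 2 (Ls j)) t U) (Ls j ^ 2) (ψ (Ls j)))
    {ω : InfVolFermionState 2} (hω : ω.IsTorusLimitOf ψ Ls)
    (h0 : (0 : Site 2) ∈ ({0, unitVec 0 + unitVec 1, unitVec 0 - unitVec 1} : Finset (Site 2)))
    (hp : (unitVec 0 + unitVec 1 : Site 2) ∈ ({0, unitVec 0 + unitVec 1, unitVec 0 - unitVec 1} : Finset (Site 2)))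
    (hm : (unitVec 0 - unitVec 1 : Site 2) ∈ ({0, unitVec 0 + unitVec 1, unitVec 0 - unitVec 1} : Finset (Site 2))) :
    (ω.expect ({0, unitVec 0 + unitVec 1, unitVec 0 - unitVec 1} : Finset (Site 2))
        (((-1/8 : ℚ) : ℂ) • ((cAt 0 h0 0)ᴴ * (cAt (unitVec 0 - unitVec 1) hm 0)ᴴ * cAt (unitVec 0 - unitVec 1) hm 0 * cAt 0 h0 0) +
        ((-1/4 : ℚ) : ℂ) • ((cAt 0 h0 0)ᴴ * (cAt (unitVec 0 - unitVec 1) hm 1)ᴴ * cAt (unitVec 0 - unitVec 1) hm 0 * cAt 0 h0 1) +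
        ((1/8 : ℚ) : ℂ) • ((cAt 0 h0 0)ᴴ * (cAt (unitVec 0 - unitVec 1) hm 1)ᴴ * cAt (unitVec 0 - unitVec 1) hm 1 * cAt 0 h0 0) +
        ((-1/8 : ℚ) : ℂ) • ((cAt 0 h0 0)ᴴ * (cAt (unitVec 0 + unitVec 1) hp 0)ᴴ * cAt (unitVec 0 + unitVec 1) hp 0 * cAt 0 h0 0) +
        ((-1/4 : ℚ) : ℂ) • ((cAt 0 h0 0)ᴴ * (cAt (unitVec 0 + unitVec 1) hp 1)ᴴ * cAt (unitVec 0 + unitVec 1) hp 0 * cAt 0 h0 1) +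
        ((1/8 : ℚ) : ℂ) • ((cAt 0 h0 0)ᴴ * (cAt (unitVec 0 + unitVec 1) hp 1)ᴴ * cAt (unitVec 0 + unitVec 1) hp 1 * cAt 0 h0 0) +
        ((1/8 : ℚ) : ℂ) • ((cAt 0 h0 1)ᴴ * (cAt (unitVec 0 - unitVec 1) hm 0)ᴴ * cAt (unitVec 0 - unitVec 1) hm 0 * cAt 0 h0 1) +
        ((-1/4 : ℚ) : ℂ) • ((cAt 0 h0 1)ᴴ * (cAt (unitVec 0 - unitVec 1) hm 0)ᴴ * cAt (unitVec 0 - unitVec 1) hm 1 * cAt 0 h0 0) +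
        ((-1/8 : ℚ) : ℂ) • ((cAt 0 h0 1)ᴴ * (cAt (unitVec 0 - unitVec 1) hm 1)ᴴ * cAt (unitVec 0 - unitVec 1) hm 1 * cAt 0 h0 1) +
        ((1/8 : ℚ) : ℂ) • ((cAt 0 h0 1)ᴴ * (cAt (unitVec 0 + unitVec 1) hp 0)ᴴ * cAt (unitVec 0 + unitVec 1) hp 0 * cAt 0 h0 1) +
        ((-1/4 : ℚ) : ℂ) • ((cAt 0 h0 1)ᴴ * (cAt (unitVec 0 + unitVec 1) hp 0)ᴴ * cAt (unitVec 0 + unitVec 1) hp 1 * cAt 0 h0 0) +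
        ((-1/8 : ℚ) : ℂ) • ((cAt 0 h0 1)ᴴ * (cAt (unitVec 0 + unitVec 1) hp 1)ᴴ * cAt (unitVec 0 + unitVec 1) hp 1 * cAt 0 h0 1))).re ≤ 0 := by
  have h := hω.re_expect_sum_spinDotAt_diag_nonneg ht hU hLs hev hψ h0 hp hm
  rw [map_add, Complex.add_re] at h
  rw [spinWords_nnn_minus_eq, map_smul, smul_eq_mul, show ((-1 / 2 : ℂ)) = ((-1 / 2 : ℝ) : ℂ) by push_cast; ring,
    Complex.re_ofReal_mul, map_add, Complex.add_re]
  linarith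

end Limit

end Literature.MathematicalPhysics.QuantumLattice

end
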